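import Summits.HodgeConjecture.HodgeConjecture.Theorems.Ring2WeilCoverageWeilGramCMPoint
import Summits.HodgeConjecture.HodgeConjecture.Theorems.Ring2WeilCoverageCyclotomicUnconditional
import Summits.HodgeConjecture.HodgeConjecture.Theorems.Ring2WeilCoverageRealUnitNormHalfSystems
import Summits.HodgeConjecture.HodgeConjecture.Theorems.Ring2WeilCoverageNormTable
import HarnessLib

/-!
# Weil-type family coverage — THE COMPONENTS OF THE WEIL-TYPE `ℤ[ζ₆₀]`-EIGHTFOLDS, I: level lemmas (`Φ₆₀(ζ) = 0`
# written out, the real frame `θ^i`, the skew generators `i = ζ¹⁵`, `s₃ = 1 + 2ζ²⁰`, `s₅ = ζ¹⁵(1 + 2(ζ¹² + ζ⁴⁸))`, `s₁₅ = (1 + 2ζ²⁰)(1 + 2(ζ¹² + ζ⁴⁸))`,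
# the census parameter `ξ = ζ⁷/Φ₆₀′(ζ)`, `θ⁸` and the trace recurrence)

research route conditional on HC_CM; not a corollary; Q11.4-sentence-2 already refuted in dim ≥ 3.

Ring 2, WEIL-TYPE FAMILY-COVERAGE CENSUS (`HOME/WEIL-FAMILY-COVERAGE.md` `## b01`, blocks b01.36 (D) (the YES rows at `60`),
b01.47–b01.49 (the component rule at the other `h = 1` levels); owner ring2-b01), part 171 of the `Ring2WeilCoverage*`
series (`K = ℚ(ζ₆₀)`, `g = 8`, `n = 4`, real frame `xᵢ = θ^i`, `θ = ζ + ζ⁻¹`, `i < 8`).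
At the level `M = 60` (`g = 8`, `h(ℚ(ζ₆₀)) = 1`) EVERY census row `(60, K_d)` is a YES row (an `ι`-compatible
PRINCIPAL polarisation exists on every `K_d`-balanced `ℂ^Φ/Φ(ℤ[ζ₆₀])`, b01.36 / parts 14–22); this series computes, for each
`K_d ⊂ ℚ(ζ₆₀)`, van Geemen's Gram determinant of the principal type in the real frame `θ^i` and places these CM points on
their component: the SPLIT row `W8.d.1` — completing the census's component column at every `h = 1` level (b01.47–b01.49
did `15, 16, 20, 24 / 21, 28, 36 / 33, 44 / 35, 45`).
For a skew `ζ′` and a skew `s` with `s² = −d`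
part 82 (`Ring2WeilCoverageWeilGramCMPoint`) shows that the Gram matrix `Ψ = a + b√−d` of van Geemen's hermitian form
`H = E(x, sy) + √−d E(x, y)`, `E = E_ζ′ = Tr_{K/ℚ}(ζ′xȳ)`, in a real frame is the rational matrix `a = (−Tr(ζ′s xᵢxⱼ))`,
`b = 0`, with `det a = (−2)^g N_{K⁺/ℚ}(ζ′s) disc(ω)`; for `n = 4` (EVEN) the split class is `Nm` itself and a `Φ`-positive
`ζ′` on a Weil-type (`(4,4)`) CM type has `(−1)⁴ det a = det a > 0` (part 92).

This file holds only the level lemmas shared by the Gram files `Ring2WeilCoverageWeilGramLevel60*` (parts 172+):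
`Φ₆₀(ζ) = 0` written out, `θ` and the frame `θ^i` are real, `ξ` is skew, the skew generators `s` (`s² = −d`, `s^ρ = −s`)
of the 4 imaginary quadratic subfields `K_d`, `d ∈ {1, 3, 5, 15}`, `θ⁸` in the frame (the minimal polynomial of
`θ`) and the trace recurrences `Tr(yθ^m)`, `8 ≤ m ≤ 14`.

HONEST FRAMING as parts 82–154: kernel statements about elements of `ℚ(ζ₆₀)`; nothing about Hodge classes, `W_K`,
general members or HC; `HC_CM` is used nowhere.  No `def`, no named fact, no `sorry`.  Certificates produced by
`work/py/geng.py` + `allyes.py` (exact arithmetic in `ℚ[x]/Φ_60`, stdlib) and re-verified here by `linear_combination`.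

References: [cite: vanGeemen1994HodgeAV, Lemma 5.2 (2)–(4)]; [cite: Shimura1998, §14.3 Prop. 4–5, pp. 103–104]; [folklore].
-/

noncomputable section

open Polynomial NumberField Module
open scoped nonZeroDivisors

namespace Summit.HodgeConjecture.Ring2WeilCoverage.WeilGramLevel60

open Literature.NumberTheory.ComplexMultiplication
open Summit.HodgeConjecture.Ring2WeilCoverage.RealUnitNormHalfSystems (complexConj_eq_inv)
open Summit.HodgeConjecture.Ring2WeilCoverage.CyclotomicPrincipalObstruction (complexConj_xi)
variable {K : Type} [Field K] [NumberField K] {ζ : K}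

/-! ### §0 Level lemmas -/

omit [NumberField K] in
/-- **`Φ₆₀(ζ) = 0` written out** (`(x³⁰ − 1)(x ^ 10 + 1)(x ^ 4 - x ^ 2 + 1)·Φ₆₀(x) = x⁶⁰ − 1`, `ζ³⁰ ≠ 1`, `ζ²⁰ ≠ 1`, `ζ¹² ≠ 1`).
research route conditional on HC_CM; not a corollary; Q11.4-sentence-2 already refuted in dim ≥ 3. [folklore] -/
theorem cyc_sixty (hζ : IsPrimitiveRoot ζ 60) :
    ζ ^ 16 + ζ ^ 14 - ζ ^ 10 - ζ ^ 8 - ζ ^ 6 + ζ ^ 2 + 1 = 0 := by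
  have h60 : ζ ^ 60 = 1 := hζ.pow_eq_one
  have ha : ζ ^ 30 - 1 ≠ 0 := sub_ne_zero.mpr (hζ.pow_ne_one_of_pos_of_lt (by norm_num) (by norm_num))
  have hc0 : ζ ^ 20 ≠ 1 := hζ.pow_ne_one_of_pos_of_lt (by norm_num) (by norm_num)
  have hF0 : ζ ^ 10 + 1 ≠ 0 := by
    intro h
    apply hc0
    linear_combination (ζ ^ 10 - 1) * h
  have hc1 : ζ ^ 12 ≠ 1 := hζ.pow_ne_one_of_pos_of_lt (by norm_num) (by norm_num)
  have hF1 : ζ ^ 4 - ζ ^ 2 + 1 ≠ 0 := by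
    intro h
    apply hc1
    linear_combination (ζ ^ 8 + ζ ^ 6 - ζ ^ 2 - 1) * h
  have h : (ζ ^ 30 - 1) * (ζ ^ 10 + 1) * (ζ ^ 4 - ζ ^ 2 + 1) *
      (ζ ^ 16 + ζ ^ 14 - ζ ^ 10 - ζ ^ 8 - ζ ^ 6 + ζ ^ 2 + 1) = 0 := by
    linear_combination h60
  rcases mul_eq_zero.mp h with h' | h'
  · exact absurd h' (mul_ne_zero (mul_ne_zero ha hF0) hF1)
  · exact h'

omit [NumberField K] in
/-- `(ζ⁻¹)^a = ζ^b` when `a + b = 60`. [folklore] -/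
theorem inv_pow_eq_pow (hζ : IsPrimitiveRoot ζ 60) {a b : ℕ} (hab : a + b = 60) : ζ⁻¹ ^ a = ζ ^ b := by
  rw [inv_pow]
  apply inv_eq_of_mul_eq_one_right
  rw [← pow_add, hab, hζ.pow_eq_one]

/-- `θ = ζ + ζ⁻¹` is real. [folklore] -/
theorem complexConj_theta [IsCMField K] (hζ : IsPrimitiveRoot ζ 60) :
    IsCMField.complexConj K (ζ + ζ⁻¹) = ζ + ζ⁻¹ := by
  rw [map_add, map_inv₀, complexConj_eq_inv hζ, inv_inv, add_comm]

/-- The frame `xᵢ = θ^i` is real. [folklore] -/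
theorem complexConj_thetaFrame [IsCMField K] (hζ : IsPrimitiveRoot ζ 60) {m : ℕ} {x : Fin m → K}
    (hx : ∀ i, x i = (ζ + ζ⁻¹) ^ (i : ℕ)) (i : Fin m) : IsCMField.complexConj K (x i) = x i := by
  rw [hx i, map_pow, complexConj_theta hζ]

/-- `ξ = ζ^7/Φ′(ζ)` is skew (part 7, `g − 1 = 7`). [folklore] -/
theorem complexConj_xi_sixty [IsCMField K] (hζ : IsPrimitiveRoot ζ 60) :
    IsCMField.complexConj K (ζ ^ 7 * (aeval ζ (derivative (cyclotomic 60 ℚ)))⁻¹) =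
      -(ζ ^ 7 * (aeval ζ (derivative (cyclotomic 60 ℚ)))⁻¹) :=
  complexConj_xi hζ (k := 7) (by decide)

/-! ### §1 The skew generators -/

omit [NumberField K] in
/-- **`(ζ¹⁵)² = −1`**: `s = √−1 = ζ¹⁵ = i` generates `K_d = ℚ(√−1) ⊂ ℚ(ζ_60)`. [folklore] -/
theorem sq_sqrtNegOne (hζ : IsPrimitiveRoot ζ 60) : (ζ ^ 15) ^ 2 = -1 := by
  linear_combination (1 - ζ^2 + ζ^4 + ζ^10 - ζ^12 + ζ^14) * cyc_sixty hζ

/-- **`s = √−1 = ζ¹⁵ = i` is skew** (`s^ρ = −s`). [folklore] -/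
theorem complexConj_sqrtNegOne [IsCMField K] (hζ : IsPrimitiveRoot ζ 60) :
    IsCMField.complexConj K (ζ ^ 15) = -(ζ ^ 15) := by
  simp only [map_pow, complexConj_eq_inv hζ]
  rw [inv_pow_eq_pow hζ (show 15 + 45 = 60 by norm_num)]
  linear_combination (ζ^15 - ζ^17 + ζ^19 + ζ^25 - ζ^27 + ζ^29) * cyc_sixty hζ

omit [NumberField K] in
/-- **`(1 + 2ζ²⁰)² = −3`**: `s = √−3 = 1 + 2ζ²⁰ (ζ₃ = ζ²⁰)` generates `K_d = ℚ(√−3) ⊂ ℚ(ζ_60)`. [folklore] -/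
theorem sq_sqrtNegThree (hζ : IsPrimitiveRoot ζ 60) : (1 + 2 * ζ ^ 20) ^ 2 = -3 := by
  linear_combination (4 - 4 * ζ^2 + 4 * ζ^4 + 4 * ζ^10 - 4 * ζ^12 + 4 * ζ^14 + 4 * ζ^20 - 4 * ζ^22 + 4 * ζ^24) * cyc_sixty hζ

/-- **`s = √−3 = 1 + 2ζ²⁰ (ζ₃ = ζ²⁰)` is skew** (`s^ρ = −s`). [folklore] -/
theorem complexConj_sqrtNegThree [IsCMField K] (hζ : IsPrimitiveRoot ζ 60) :
    IsCMField.complexConj K (1 + 2 * ζ ^ 20) = -(1 + 2 * ζ ^ 20) := by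
  simp only [map_add, map_mul, map_pow, map_one, map_ofNat, complexConj_eq_inv hζ]
  rw [inv_pow_eq_pow hζ (show 20 + 40 = 60 by norm_num)]
  linear_combination (2 - 2 * ζ^2 + 2 * ζ^4 + 2 * ζ^10 - 2 * ζ^12 + 2 * ζ^14 + 2 * ζ^20 - 2 * ζ^22 + 2 * ζ^24) * cyc_sixty hζ

omit [NumberField K] in
/-- **`(ζ¹⁵(1 + 2(ζ¹² + ζ⁴⁸)))² = −5`**: `s = √−5 = ζ¹⁵·(1 + 2(ζ¹² + ζ⁴⁸)) = i·√5 (Gauss sum of ζ₅ = ζ¹²)` generates `K_d = ℚ(√−5) ⊂ ℚ(ζ_60)`. [folklore] -/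
theorem sq_sqrtNegFive (hζ : IsPrimitiveRoot ζ 60) : (ζ ^ 15 * (1 + 2 * (ζ ^ 12 + ζ ^ 48))) ^ 2 = -5 := by
  have h60 : ζ ^ 60 = 1 := hζ.pow_eq_one
  linear_combination (5 - 5 * ζ^2 + 5 * ζ^4 + 4 * ζ^6 - 4 * ζ^8 + 9 * ζ^10 - 5 * ζ^12 + 5 * ζ^14 + 4 * ζ^16 + 4 * ζ^22 + 4 * ζ^28 + 4 * ζ^34 - 4 * ζ^36 + 4 * ζ^38) * cyc_sixty hζ +
    (4 * ζ^6 + 4 * ζ^18 + 8 * ζ^30 + 4 * ζ^66) * h60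

/-- **`s = √−5 = ζ¹⁵·(1 + 2(ζ¹² + ζ⁴⁸)) = i·√5 (Gauss sum of ζ₅ = ζ¹²)` is skew** (`s^ρ = −s`). [folklore] -/
theorem complexConj_sqrtNegFive [IsCMField K] (hζ : IsPrimitiveRoot ζ 60) :
    IsCMField.complexConj K (ζ ^ 15 * (1 + 2 * (ζ ^ 12 + ζ ^ 48))) = -(ζ ^ 15 * (1 + 2 * (ζ ^ 12 + ζ ^ 48))) := by
  have h60 : ζ ^ 60 = 1 := hζ.pow_eq_one
  simp only [map_add, map_mul, map_pow, map_one, map_ofNat, complexConj_eq_inv hζ]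
  rw [inv_pow_eq_pow hζ (show 12 + 48 = 60 by norm_num), inv_pow_eq_pow hζ (show 15 + 45 = 60 by norm_num), inv_pow_eq_pow hζ (show 48 + 12 = 60 by norm_num)]
  linear_combination (2 * ζ^3 - 2 * ζ^5 + 2 * ζ^7 + 2 * ζ^13 - ζ^15 + ζ^17 + ζ^19 + ζ^25 + ζ^27 - ζ^29 + 2 * ζ^31 + 2 * ζ^37 - 2 * ζ^39 + 2 * ζ^41) * cyc_sixty hζ +
    (2 * ζ^3 + 2 * ζ^33) * h60

omit [NumberField K] in
/-- **`((1 + 2ζ²⁰)(1 + 2(ζ¹² + ζ⁴⁸)))² = −15`**: `s = √−15 = (1 + 2ζ²⁰)(1 + 2(ζ¹² + ζ⁴⁸)) = √−3·√5` generates `K_d = ℚ(√−15) ⊂ ℚ(ζ_60)`. [folklore] -/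
theorem sq_sqrtNegFifteen (hζ : IsPrimitiveRoot ζ 60) : ((1 + 2 * ζ ^ 20) * (1 + 2 * (ζ ^ 12 + ζ ^ 48))) ^ 2 = -15 := by
  have h60 : ζ ^ 60 = 1 := hζ.pow_eq_one
  linear_combination (24 - 24 * ζ^2 + 40 * ζ^4 - 16 * ζ^6 + 32 * ζ^8 + 8 * ζ^10 - 4 * ζ^12 + 36 * ζ^14 + 4 * ζ^16 + 16 * ζ^18 + 36 * ζ^20 - 16 * ζ^22 + 36 * ζ^24 + 16 * ζ^26 + 4 * ζ^28 + 12 * ζ^30 + 20 * ζ^32 - 16 * ζ^34 + 32 * ζ^36 - 16 * ζ^38 + 16 * ζ^40) * cyc_sixty hζ +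
    (8 + 16 * ζ^4 + 16 * ζ^8 + 16 * ζ^16 + 32 * ζ^20 + 16 * ζ^28 + 4 * ζ^36 + 32 * ζ^40 + 16 * ζ^56 + 16 * ζ^76) * h60

/-- **`s = √−15 = (1 + 2ζ²⁰)(1 + 2(ζ¹² + ζ⁴⁸)) = √−3·√5` is skew** (`s^ρ = −s`). [folklore] -/
theorem complexConj_sqrtNegFifteen [IsCMField K] (hζ : IsPrimitiveRoot ζ 60) :
    IsCMField.complexConj K ((1 + 2 * ζ ^ 20) * (1 + 2 * (ζ ^ 12 + ζ ^ 48))) = -((1 + 2 * ζ ^ 20) * (1 + 2 * (ζ ^ 12 + ζ ^ 48))) := by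
  have h60 : ζ ^ 60 = 1 := hζ.pow_eq_one
  simp only [map_add, map_mul, map_pow, map_one, map_ofNat, complexConj_eq_inv hζ]
  rw [inv_pow_eq_pow hζ (show 12 + 48 = 60 by norm_num), inv_pow_eq_pow hζ (show 20 + 40 = 60 by norm_num), inv_pow_eq_pow hζ (show 48 + 12 = 60 by norm_num)]
  linear_combination (2 - 2 * ζ^2 + 2 * ζ^4 + 4 * ζ^8 - 2 * ζ^10 + 6 * ζ^12 - 2 * ζ^14 + 4 * ζ^16 + 4 * ζ^18 - 2 * ζ^20 + 6 * ζ^22 - 2 * ζ^24 + 4 * ζ^26 + 4 * ζ^28 - 4 * ζ^30 + 8 * ζ^32 - 4 * ζ^34 + 4 * ζ^36) * cyc_sixty hζ +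
    (4 * ζ^8 + 4 * ζ^28) * h60

/-! ### §2 `θ^8` on the frame and the trace recurrence -/

/-- **`θ^8` on the frame**: the minimal polynomial of `θ = ζ + ζ⁻¹` over `ℚ` (`Φ_60(x) = x^8ψ(x + x⁻¹)`), i.e.
`θ^8 = -1 + 8 * θ ^ 2 - 14 * θ ^ 4 + 7 * θ ^ 6`. research route conditional on HC_CM; not a corollary; Q11.4-sentence-2 already refuted in dim ≥ 3. [folklore] -/
theorem theta_pow_eight (hζ : IsPrimitiveRoot ζ 60) :
    (ζ + ζ⁻¹) ^ 8 = -1 + 8 * (ζ + ζ⁻¹) ^ 2 - 14 * (ζ + ζ⁻¹) ^ 4 + 7 * (ζ + ζ⁻¹) ^ 6 := by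
  have hζ0 : ζ ≠ 0 := hζ.ne_zero (by norm_num)
  have hΦ := cyc_sixty hζ
  have hθ : (ζ + ζ⁻¹) * ζ = ζ ^ 2 + 1 := by rw [add_mul, inv_mul_cancel₀ hζ0]; ring
  apply mul_right_cancel₀ (pow_ne_zero 8 hζ0)
  calc (ζ + ζ⁻¹) ^ 8 * ζ ^ 8 = ((ζ + ζ⁻¹) * ζ) ^ 8 := by ring
    _ = (ζ ^ 2 + 1) ^ 8 := by rw [hθ]
    _ = -ζ ^ 8 + 8 * (ζ ^ 2 + 1) ^ 2 * ζ ^ 6 - 14 * (ζ ^ 2 + 1) ^ 4 * ζ ^ 4 + 7 * (ζ ^ 2 + 1) ^ 6 * ζ ^ 2 := by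
      linear_combination hΦ
    _ = -ζ ^ 8 + 8 * ((ζ + ζ⁻¹) * ζ) ^ 2 * ζ ^ 6 - 14 * ((ζ + ζ⁻¹) * ζ) ^ 4 * ζ ^ 4 +
        7 * ((ζ + ζ⁻¹) * ζ) ^ 6 * ζ ^ 2 := by
      rw [hθ]
    _ = (-1 + 8 * (ζ + ζ⁻¹) ^ 2 - 14 * (ζ + ζ⁻¹) ^ 4 + 7 * (ζ + ζ⁻¹) ^ 6) * ζ ^ 8 := by
      ring

/-- The trace recurrence at `θ^8`: `Tr(y·θ^8) = Σ eₖ·Tr(y·θ^{0+k})` from `θ^8 = Σ eₖ θ^k`. [folklore] -/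
theorem trace_mul_theta_pow_eight (hζ : IsPrimitiveRoot ζ 60) (y : K) :
    Algebra.trace ℚ K (y * (ζ + ζ⁻¹) ^ 8) =
      (-1) * Algebra.trace ℚ K (y) + 8 * Algebra.trace ℚ K (y * (ζ + ζ⁻¹) ^ 2) +
      (-14) * Algebra.trace ℚ K (y * (ζ + ζ⁻¹) ^ 4) + 7 * Algebra.trace ℚ K (y * (ζ + ζ⁻¹) ^ 6) := by
  have e : y * (ζ + ζ⁻¹) ^ 8 =
      (-1 : ℚ) • (y) + (8 : ℚ) • (y * (ζ + ζ⁻¹) ^ 2) + (-14 : ℚ) • (y * (ζ + ζ⁻¹) ^ 4) +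
      (7 : ℚ) • (y * (ζ + ζ⁻¹) ^ 6) := by
    conv_lhs => rw [theta_pow_eight hζ]
    simp only [Rat.smul_def]
    push_cast
    ring
  rw [e]
  simp only [map_add, map_smul, smul_eq_mul]

/-- The trace recurrence at `θ^9`: `Tr(y·θ^9) = Σ eₖ·Tr(y·θ^{1+k})` from `θ^8 = Σ eₖ θ^k`. [folklore] -/
theorem trace_mul_theta_pow_nine (hζ : IsPrimitiveRoot ζ 60) (y : K) :
    Algebra.trace ℚ K (y * (ζ + ζ⁻¹) ^ 9) =
      (-1) * Algebra.trace ℚ K (y * (ζ + ζ⁻¹)) + 8 * Algebra.trace ℚ K (y * (ζ + ζ⁻¹) ^ 3) +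
      (-14) * Algebra.trace ℚ K (y * (ζ + ζ⁻¹) ^ 5) + 7 * Algebra.trace ℚ K (y * (ζ + ζ⁻¹) ^ 7) := by
  have e : y * (ζ + ζ⁻¹) ^ 9 =
      (-1 : ℚ) • (y * (ζ + ζ⁻¹)) + (8 : ℚ) • (y * (ζ + ζ⁻¹) ^ 3) + (-14 : ℚ) • (y * (ζ + ζ⁻¹) ^ 5) +
      (7 : ℚ) • (y * (ζ + ζ⁻¹) ^ 7) := by
    conv_lhs => rw [show y * (ζ + ζ⁻¹) ^ 9 = y * (ζ + ζ⁻¹) * (ζ + ζ⁻¹) ^ 8 by ring, theta_pow_eight hζ]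
    simp only [Rat.smul_def]
    push_cast
    ring
  rw [e]
  simp only [map_add, map_smul, smul_eq_mul]

/-- The trace recurrence at `θ^10`: `Tr(y·θ^10) = Σ eₖ·Tr(y·θ^{2+k})` from `θ^8 = Σ eₖ θ^k`. [folklore] -/
theorem trace_mul_theta_pow_ten (hζ : IsPrimitiveRoot ζ 60) (y : K) :
    Algebra.trace ℚ K (y * (ζ + ζ⁻¹) ^ 10) =
      (-1) * Algebra.trace ℚ K (y * (ζ + ζ⁻¹) ^ 2) + 8 * Algebra.trace ℚ K (y * (ζ + ζ⁻¹) ^ 4) +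
      (-14) * Algebra.trace ℚ K (y * (ζ + ζ⁻¹) ^ 6) + 7 * Algebra.trace ℚ K (y * (ζ + ζ⁻¹) ^ 8) := by
  have e : y * (ζ + ζ⁻¹) ^ 10 =
      (-1 : ℚ) • (y * (ζ + ζ⁻¹) ^ 2) + (8 : ℚ) • (y * (ζ + ζ⁻¹) ^ 4) + (-14 : ℚ) • (y * (ζ + ζ⁻¹) ^ 6) +
      (7 : ℚ) • (y * (ζ + ζ⁻¹) ^ 8) := by
    conv_lhs => rw [show y * (ζ + ζ⁻¹) ^ 10 = y * (ζ + ζ⁻¹) ^ 2 * (ζ + ζ⁻¹) ^ 8 by ring, theta_pow_eight hζ]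
    simp only [Rat.smul_def]
    push_cast
    ring
  rw [e]
  simp only [map_add, map_smul, smul_eq_mul]

/-- The trace recurrence at `θ^11`: `Tr(y·θ^11) = Σ eₖ·Tr(y·θ^{3+k})` from `θ^8 = Σ eₖ θ^k`. [folklore] -/
theorem trace_mul_theta_pow_eleven (hζ : IsPrimitiveRoot ζ 60) (y : K) :
    Algebra.trace ℚ K (y * (ζ + ζ⁻¹) ^ 11) =
      (-1) * Algebra.trace ℚ K (y * (ζ + ζ⁻¹) ^ 3) + 8 * Algebra.trace ℚ K (y * (ζ + ζ⁻¹) ^ 5) +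
      (-14) * Algebra.trace ℚ K (y * (ζ + ζ⁻¹) ^ 7) + 7 * Algebra.trace ℚ K (y * (ζ + ζ⁻¹) ^ 9) := by
  have e : y * (ζ + ζ⁻¹) ^ 11 =
      (-1 : ℚ) • (y * (ζ + ζ⁻¹) ^ 3) + (8 : ℚ) • (y * (ζ + ζ⁻¹) ^ 5) + (-14 : ℚ) • (y * (ζ + ζ⁻¹) ^ 7) +
      (7 : ℚ) • (y * (ζ + ζ⁻¹) ^ 9) := by
    conv_lhs => rw [show y * (ζ + ζ⁻¹) ^ 11 = y * (ζ + ζ⁻¹) ^ 3 * (ζ + ζ⁻¹) ^ 8 by ring, theta_pow_eight hζ]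
    simp only [Rat.smul_def]
    push_cast
    ring
  rw [e]
  simp only [map_add, map_smul, smul_eq_mul]

/-- The trace recurrence at `θ^12`: `Tr(y·θ^12) = Σ eₖ·Tr(y·θ^{4+k})` from `θ^8 = Σ eₖ θ^k`. [folklore] -/
theorem trace_mul_theta_pow_twelve (hζ : IsPrimitiveRoot ζ 60) (y : K) :
    Algebra.trace ℚ K (y * (ζ + ζ⁻¹) ^ 12) =
      (-1) * Algebra.trace ℚ K (y * (ζ + ζ⁻¹) ^ 4) + 8 * Algebra.trace ℚ K (y * (ζ + ζ⁻¹) ^ 6) +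
      (-14) * Algebra.trace ℚ K (y * (ζ + ζ⁻¹) ^ 8) + 7 * Algebra.trace ℚ K (y * (ζ + ζ⁻¹) ^ 10) := by
  have e : y * (ζ + ζ⁻¹) ^ 12 =
      (-1 : ℚ) • (y * (ζ + ζ⁻¹) ^ 4) + (8 : ℚ) • (y * (ζ + ζ⁻¹) ^ 6) + (-14 : ℚ) • (y * (ζ + ζ⁻¹) ^ 8) +
      (7 : ℚ) • (y * (ζ + ζ⁻¹) ^ 10) := by
    conv_lhs => rw [show y * (ζ + ζ⁻¹) ^ 12 = y * (ζ + ζ⁻¹) ^ 4 * (ζ + ζ⁻¹) ^ 8 by ring, theta_pow_eight hζ]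
    simp only [Rat.smul_def]
    push_cast
    ring
  rw [e]
  simp only [map_add, map_smul, smul_eq_mul]

/-- The trace recurrence at `θ^13`: `Tr(y·θ^13) = Σ eₖ·Tr(y·θ^{5+k})` from `θ^8 = Σ eₖ θ^k`. [folklore] -/
theorem trace_mul_theta_pow_thirteen (hζ : IsPrimitiveRoot ζ 60) (y : K) :
    Algebra.trace ℚ K (y * (ζ + ζ⁻¹) ^ 13) =
      (-1) * Algebra.trace ℚ K (y * (ζ + ζ⁻¹) ^ 5) + 8 * Algebra.trace ℚ K (y * (ζ + ζ⁻¹) ^ 7) +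
      (-14) * Algebra.trace ℚ K (y * (ζ + ζ⁻¹) ^ 9) + 7 * Algebra.trace ℚ K (y * (ζ + ζ⁻¹) ^ 11) := by
  have e : y * (ζ + ζ⁻¹) ^ 13 =
      (-1 : ℚ) • (y * (ζ + ζ⁻¹) ^ 5) + (8 : ℚ) • (y * (ζ + ζ⁻¹) ^ 7) + (-14 : ℚ) • (y * (ζ + ζ⁻¹) ^ 9) +
      (7 : ℚ) • (y * (ζ + ζ⁻¹) ^ 11) := by
    conv_lhs => rw [show y * (ζ + ζ⁻¹) ^ 13 = y * (ζ + ζ⁻¹) ^ 5 * (ζ + ζ⁻¹) ^ 8 by ring, theta_pow_eight hζ]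
    simp only [Rat.smul_def]
    push_cast
    ring
  rw [e]
  simp only [map_add, map_smul, smul_eq_mul]

/-- The trace recurrence at `θ^14`: `Tr(y·θ^14) = Σ eₖ·Tr(y·θ^{6+k})` from `θ^8 = Σ eₖ θ^k`. [folklore] -/
theorem trace_mul_theta_pow_fourteen (hζ : IsPrimitiveRoot ζ 60) (y : K) :
    Algebra.trace ℚ K (y * (ζ + ζ⁻¹) ^ 14) =
      (-1) * Algebra.trace ℚ K (y * (ζ + ζ⁻¹) ^ 6) + 8 * Algebra.trace ℚ K (y * (ζ + ζ⁻¹) ^ 8) +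
      (-14) * Algebra.trace ℚ K (y * (ζ + ζ⁻¹) ^ 10) + 7 * Algebra.trace ℚ K (y * (ζ + ζ⁻¹) ^ 12) := by
  have e : y * (ζ + ζ⁻¹) ^ 14 =
      (-1 : ℚ) • (y * (ζ + ζ⁻¹) ^ 6) + (8 : ℚ) • (y * (ζ + ζ⁻¹) ^ 8) + (-14 : ℚ) • (y * (ζ + ζ⁻¹) ^ 10) +
      (7 : ℚ) • (y * (ζ + ζ⁻¹) ^ 12) := by
    conv_lhs => rw [show y * (ζ + ζ⁻¹) ^ 14 = y * (ζ + ζ⁻¹) ^ 6 * (ζ + ζ⁻¹) ^ 8 by ring, theta_pow_eight hζ]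
    simp only [Rat.smul_def]
    push_cast
    ring
  rw [e]
  simp only [map_add, map_smul, smul_eq_mul]

end Summit.HodgeConjecture.Ring2WeilCoverage.WeilGramLevel60

end
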